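import Literature.Geometry.Lorentzian.HypersurfaceShadowDomain
import Literature.Geometry.Lorentzian.CausalCurveEndpoint
import Literature.Geometry.Lorentzian.CauchyPieceDomain
import HarnessLib

/-!
# The shadow domain of an acausal hypersurface: the hypersurface is a Cauchy hypersurface of it

Continuation of `HypersurfaceShadowDomain` (same setting and notation: `V = S ∪ V⁺ ∪ V⁻`, the sets
entering through defining equations). **Theorem (`isCauchyHypersurface_shadowDomain`): `S` is a
Cauchy hypersurface of the open sub-spacetime `V`.** Uniqueness of the crossing is acausality.
Existence (`false_of_curve_in_shadowDomain_future` and its time dual): let `γ` be a future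
timelike curve in `V` missing `S`, through `p = γ t₀ ∈ V⁺` (`p ≪ x`, `ι⁻¹ J⁻(x)` compact), with no
past endpoint in `V`. Then `γ ⊆ I⁺(S)` (`V ∖ S = V⁺ ⊔ V⁻` with `V± ⊆ I±(S)` disjoint open, `γ`
connected), and the shadows of the points `γ t`, `t ≤ t₀`, lie in the compact `C = ι(K) ⊆ S`.
If `γ` has no past endpoint in `M`, the horizon lemma
(`exists_mem_of_isPastEndless_of_shadow_subset`, with `J⁺(S) ⊆ S ∪ I⁺(S)` from the local
trichotomy) makes it meet `S` — contradiction. Otherwise its past endpoint `e ∉ V` satisfies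
`e ≪ γ t` (endpoint lemma `mem_chronologicalFuture_of_hasPastEndpoint`): `e ∈ I⁺(S)` would give
`e ∈ I⁻(x) ∩ I⁺(S) ⊆ V⁺`; `e ∈ S ⊆ V` is excluded; and for `e ∉ S ∪ I⁺(S)` the endless extension
`Δ` of a timelike segment from `e` to `γ t₁` (`exists_isEndlessTimelikeCurve_extends`) meets `S`
below `γ t₁` by the horizon lemma, at a point `r`: `r` strictly between `e` and `γ t₁` puts `e` in
the open set `I⁻(S)`, which then contains points `γ t ∈ I⁺(S)` — against achronality; `r = e` and
`r ≪ e` contradict `e ∉ S ∪ I⁺(S)`. This is Hawking–Ellis 1973, Prop. 6.6.3 / O'Neill 1983,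
Thm. 14.38 ("`int D(S)` is globally hyperbolic with Cauchy hypersurface `S`") for the shadow
domain, proved without limit curves.

Everything is proved; no definitions, no named facts (D-0026).

## References

* B. O'Neill, *Semi-Riemannian geometry with applications to relativity*, Academic Press 1983,
  Ch. 14, Lemma 14.29, Def. 14.35, Thm. 14.38, Lemma 14.43. [ONeillSemiRiemannian1983]
* S. W. Hawking, G. F. R. Ellis, *The large scale structure of space-time*, CUP 1973, §6.5–6.6,
  Prop. 6.6.3. [HawkingEllis1973CUP]
-/

noncomputable section

open Set Filter Function TopologicalSpace Topology
open scoped Manifold ContDiff Topology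

namespace Literature.Geometry.Lorentzian

/-! ### Endlessness of an initial segment -/

/-- The initial segment `D ∩ (-∞, b]`, `b ∈ D`, of a past-endless curve is past endless (a past
endpoint only depends on the past end of the parameter set). [folklore] -/
theorem IsPastEndless.inter_Iic {M : Type*} [TopologicalSpace M] {Δ : ℝ → M} {D : Set ℝ}
    (h : IsPastEndless Δ D) {b : ℝ} (hb : b ∈ D) : IsPastEndless Δ (D ∩ Iic b) := by
  refine ⟨⟨b, hb, self_mem_Iic⟩, fun e he ↦ h.2 e ?_⟩
  rw [hasPastEndpoint_iff (⟨b, hb, self_mem_Iic⟩ : (D ∩ Iic b).Nonempty)] at he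
  rw [hasPastEndpoint_iff ⟨b, hb⟩]
  intro V hV
  obtain ⟨t, ht, htV⟩ := he V hV
  exact ⟨t, ht.1, fun t₁ ht₁ ht₁t ↦ htV t₁ ⟨ht₁, ht₁t.trans ht.2⟩ ht₁t⟩

namespace LorentzianMetric

variable {E : Type*} [NormedAddCommGroup E] [NormedSpace ℝ E] {H : Type*} [TopologicalSpace H]
  {I : ModelWithCorners ℝ E H} {n : ℕ∞ω} {M : Type*} [TopologicalSpace M] [ChartedSpace H M]
  [IsManifold I ∞ M] [T2Space M] [SecondCountableTopology M] [I.Boundaryless]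
  [FiniteDimensional ℝ E] [CompleteSpace E] {g : LorentzianMetric I n M} [g.HasLeviCivita]
  [CovariantDerivative.ContMDiffCovariantDerivative g.leviCivita 1] {τ : TimeOrientation g}
  {X' : Type*} [TopologicalSpace X'] {ι : X' → M}

/-! ### A timelike curve of the shadow domain missing `S`, through a point of `V⁺` -/

/-- **No future timelike curve of the shadow domain through a point of `V⁺` misses `S`, unless it
has a past endpoint in `V`.** See the module docstring for the proof (connectedness puts the
curve in `I⁺(S)`; horizon lemma for a curve without past endpoint; endpoint lemma, extension and
horizon lemma again for a curve with past endpoint `e ∉ V`).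
[cite: HawkingEllis1973CUP, §6.6, Prop. 6.6.3] [cite: ONeillSemiRiemannian1983, Ch. 14, Thm. 14.38] -/
theorem false_of_curve_in_shadowDomain_future (hsm : (∞ : ℕ∞ω) ≤ n)
    (hcwb : g.IsCausallyWellBehaved τ) (hιc : Continuous ι)
    (hac : ∀ p ∈ range ι, ∀ q ∈ range ι, q ∈ g.causalFuture τ {p} → q = p)
    (hLT : ∀ u : X', ∃ B : Set M, IsOpen B ∧ ι u ∈ B ∧
      B ⊆ range ι ∪ g.chronologicalFuture τ (range ι) ∪ g.chronologicalPast τ (range ι))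
    (hrel : ∀ {xs ys : ℕ → M} {x y : M}, Tendsto xs atTop (𝓝 x) → Tendsto ys atTop (𝓝 y) →
      (∀ j, ys j ∈ g.causalFuture τ {xs j}) → y ∈ g.causalFuture τ {x})
    (hKC : ∀ C : Set M, IsCompact C → ∀ y : M,
      IsCompact (g.causalFuture τ C ∩ g.causalPast τ {y}))
    (himp : ∀ K : Set M, IsCompact K → ∀ (γ : ℝ → M) (s : Set ℝ), s.OrdConnected →
      g.IsFutureCausalCurveOn τ γ s → IsPastEndless γ s → ∀ t₀ ∈ s, ∃ t ∈ s, t ≤ t₀ ∧ γ t ∉ K)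
    {Vp Vm : Set M}
    (hVp : Vp = {y | y ∈ g.chronologicalFuture τ (range ι) ∧ ∃ x ∈ g.chronologicalFuture τ {y},
      ∃ K : Set X', IsCompact K ∧ ι ⁻¹' g.causalPast τ {x} ⊆ K})
    (hVm : Vm = {y | y ∈ g.chronologicalPast τ (range ι) ∧ ∃ x ∈ g.chronologicalPast τ {y},
      ∃ K : Set X', IsCompact K ∧ ι ⁻¹' g.causalFuture τ {x} ⊆ K})
    {γ : ℝ → M} {s : Set ℝ} (hs : s.OrdConnected) (hγ : g.IsFutureTimelikeCurveOn τ γ s)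
    (hγV : ∀ t ∈ s, γ t ∈ range ι ∪ Vp ∪ Vm) (hmiss : ∀ t ∈ s, γ t ∉ range ι)
    {t₀ : ℝ} (ht₀ : t₀ ∈ s) (hp : γ t₀ ∈ Vp)
    (hend : ∀ e ∈ range ι ∪ Vp ∪ Vm, ¬ HasPastEndpoint γ s e) : False := by
  classical
  subst hVp hVm
  haveI : BoundarylessManifold I M := inferInstance
  have hn : (2 : ℕ∞ω) ≤ n := le_trans (WithTop.coe_le_coe.mpr le_top : (2 : ℕ∞ω) ≤ ∞) hsm
  have hn1 : (1 : ℕ∞ω) ≤ n := le_trans one_le_two hn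
  have hJS := causalFuture_subset_of_localTrichotomy hn hcwb hac hLT
  -- `I⁺(S)` and `I⁻(S)` are disjoint
  have hdisj : ∀ z, z ∈ g.chronologicalFuture τ (range ι) → z ∈ g.chronologicalPast τ (range ι) →
      False := by
    intro z hzf hzp
    rw [chronologicalPast, chronologicalFuture_eq_biUnion] at hzp
    simp only [mem_iUnion, exists_prop] at hzp
    obtain ⟨s₂, hs₂, hzs₂⟩ := hzp
    have h1 : s₂ ∈ g.chronologicalFuture τ {z} := mem_chronologicalFuture_of_mem_chronologicalPast hzs₂
    exact not_mem_range_of_mem_chronologicalFuture_range hcwb hac (mem_chronologicalFuture_trans hzf h1) hs₂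
  -- the curve lies in `I⁺(S)`
  have hI : ∀ t ∈ s, γ t ∈ g.chronologicalFuture τ (range ι) := by
    have hA : IsPreconnected (γ '' s) :=
      hs.isPreconnected.image γ fun t ht ↦ (hγ t ht).1.continuousAt.continuousWithinAt
    have hsub : γ '' s ⊆ g.chronologicalFuture τ (range ι) ∪ g.chronologicalPast τ (range ι) := by
      rintro _ ⟨t, ht, rfl⟩
      rcases hγV t ht with (hS | hVp) | hVm
      · exact absurd hS (hmiss t ht)
      · exact Or.inl hVp.1
      · exact Or.inr hVm.1
    have h := hA.subset_left_of_subset_union (isOpen_chronologicalFuture_of_boundaryless g τ _)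
      (isOpen_chronologicalPast_of_boundaryless g τ _)
      (disjoint_left.2 fun z hzf hzp ↦ hdisj z hzf hzp) hsub ⟨γ t₀, ⟨t₀, ht₀, rfl⟩, hp.1⟩
    exact fun t ht ↦ h ⟨t, ht, rfl⟩
  -- the compact set `C = ι(K)` containing the shadows of the points `γ t`, `t ≤ t₀`
  obtain ⟨-, x, hxp, K, hK, hsh⟩ := hp
  set C : Set M := ι '' K with hC
  have hCc : IsCompact C := hK.image hιc
  have hCS : C ⊆ range ι := image_subset_range _ _
  have hshadow : ∀ t ∈ s, t ≤ t₀ → g.chronologicalPast τ {γ t} ∩ range ι ⊆ C := by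
    rintro t ht htt₀ z ⟨hzt, ⟨v, rfl⟩⟩
    have h1 : γ t ∈ g.chronologicalFuture τ {ι v} := mem_chronologicalFuture_of_mem_chronologicalPast hzt
    have h2 : γ t₀ ∈ g.chronologicalFuture τ {ι v} := by
      rcases eq_or_lt_of_le htt₀ with heq | hlt
      · rw [← heq]; exact h1
      · exact mem_chronologicalFuture_trans h1
          ⟨γ t, rfl, γ, t, t₀, hlt, hγ.mono (hs.out ht ht₀), rfl, rfl⟩
    have h3 : x ∈ g.chronologicalFuture τ {ι v} := mem_chronologicalFuture_trans h2 hxp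
    exact ⟨v, hsh (mem_causalPast_singleton_iff.2 (chronologicalFuture_subset_causalFuture g τ _ h3)),
      rfl⟩
  by_cases hE : ∃ e, HasPastEndpoint γ s e
  swap
  · -- no past endpoint in `M`: the horizon lemma makes `γ` meet `S`
    have hendless : IsPastEndless γ s := ⟨⟨t₀, ht₀⟩, fun e he ↦ hE ⟨e, he⟩⟩
    obtain ⟨t, ht, -, htS⟩ := exists_mem_of_isPastEndless_of_shadow_subset hn1 hCS hCc hJS hrel
      (hKC C hCc) himp (hI t₀ ht₀) (hshadow t₀ ht₀ le_rfl) hs hγ.isFutureCausalCurveOn hendless ht₀ rfl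
    exact hmiss t ht htS
  obtain ⟨e, he⟩ := hE
  have heV : e ∉ range ι ∪
      {y | y ∈ g.chronologicalFuture τ (range ι) ∧ ∃ x ∈ g.chronologicalFuture τ {y},
        ∃ K : Set X', IsCompact K ∧ ι ⁻¹' g.causalPast τ {x} ⊆ K} ∪
      {y | y ∈ g.chronologicalPast τ (range ι) ∧ ∃ x ∈ g.chronologicalPast τ {y},
        ∃ K : Set X', IsCompact K ∧ ι ⁻¹' g.causalFuture τ {x} ⊆ K} := fun h ↦ hend e h he
  -- `s` has no least element (its image would be the endpoint, a point of `V`)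
  have hnoleast : ∀ t ∈ s, ∃ t' ∈ s, t' < t := by
    intro t ht
    by_contra hcon
    push Not at hcon
    have hleast : IsLeast s t := ⟨ht, fun t' ht' ↦ hcon t' ht'⟩
    haveI : Nonempty s := ⟨⟨t, ht⟩⟩
    have heq : e = γ t := tendsto_nhds_unique he (hasPastEndpoint_of_isLeast hleast)
    exact heV (heq ▸ hγV t ht)
  -- `e ≪ γ t` for every `t ∈ s`
  have hell : ∀ t ∈ s, γ t ∈ g.chronologicalFuture τ {e} := by
    intro t ht
    obtain ⟨t', ht', hlt⟩ := hnoleast t ht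
    exact mem_chronologicalFuture_of_hasPastEndpoint τ hsm hs hγ he ht' ht hlt
  by_cases heI : e ∈ g.chronologicalFuture τ (range ι)
  · -- `e ∈ I⁺(S)`: then `e ∈ V⁺`
    exact heV (Or.inl (Or.inr ⟨heI, x, mem_chronologicalFuture_trans (hell t₀ ht₀) hxp, K, hK, hsh⟩))
  have heS : e ∉ range ι := fun h ↦ heV (Or.inl (Or.inl h))
  -- a timelike segment from `e` to `γ t₁`, `t₁ < t₀`, extended to an endless timelike curve `Δ`
  obtain ⟨t₁, ht₁, ht₁₀⟩ := hnoleast t₀ ht₀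
  obtain ⟨e₀, he₀, σ, a, b, hab, hσ, hσa, hσb⟩ := hell t₁ ht₁
  rw [mem_singleton_iff] at he₀
  rw [he₀] at hσa
  obtain ⟨Δ, D, hΔ, haD, hbD, hΔa, hΔb⟩ := exists_isEndlessTimelikeCurve_extends hn hab hσ
  obtain ⟨hDord, hΔt, -, hΔp⟩ := hΔ
  rw [hσa] at hΔa
  rw [hσb] at hΔb
  -- the past half of `Δ` from `γ t₁` meets `S` (horizon lemma)
  have hD'ord : (D ∩ Iic b).OrdConnected := hDord.inter ordConnected_Iic
  obtain ⟨t', ⟨ht'D, ht'b⟩, -, hr⟩ := exists_mem_of_isPastEndless_of_shadow_subset hn1 hCS hCc hJS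
    hrel (hKC C hCc) himp (hI t₁ ht₁) (hshadow t₁ ht₁ ht₁₀.le) hD'ord
    (hΔt.isFutureCausalCurveOn.mono inter_subset_left) (hΔp.inter_Iic hbD) ⟨hbD, self_mem_Iic⟩ hΔb
  -- compare the crossing parameter `t'` with `a` (`Δ a = e`) and `b` (`Δ b = γ t₁`)
  rcases lt_trichotomy t' a with hlt | heq | hgt
  · -- `Δ t' ≪ Δ a = e`: `e ∈ I⁺(S)`
    have h : e ∈ g.chronologicalFuture τ {Δ t'} := by
      rw [← hΔa]
      exact ⟨Δ t', rfl, Δ, t', a, hlt, hΔt.mono (hDord.out ht'D haD), rfl, rfl⟩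
    exact heI (chronologicalFuture_mono (singleton_subset_iff.2 hr) h)
  · -- `Δ t' = e ∈ S`
    rw [heq, hΔa] at hr
    exact heS hr
  · rcases eq_or_lt_of_le (show t' ≤ b from ht'b) with heq | hlt
    · -- `Δ b = γ t₁ ∈ S`
      rw [heq, hΔb] at hr
      exact hmiss t₁ ht₁ hr
    · -- `e = Δ a ≪ Δ t' ∈ S`: `e ∈ I⁻(S)`, an open set containing points `γ t ∈ I⁺(S)`
      have h : Δ t' ∈ g.chronologicalFuture τ {e} := by
        rw [← hΔa]
        exact ⟨Δ a, rfl, Δ, a, t', hgt, hΔt.mono (hDord.out haD ht'D), rfl, rfl⟩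
      have heP : e ∈ g.chronologicalPast τ (range ι) :=
        chronologicalFuture_mono (τ := τ.reverse) (singleton_subset_iff.2 hr)
          (mem_chronologicalPast_of_mem_chronologicalFuture h)
      obtain ⟨t, ht, htP⟩ := he.exists_mem_of_mem_nhds ⟨t₀, ht₀⟩
        ((isOpen_chronologicalPast_of_boundaryless g τ _).mem_nhds heP)
      exact hdisj (γ t) (hI t ht) htP

/-- **Time dual: through a point of `V⁻`, no future timelike curve of the shadow domain without
FUTURE endpoint in `V` misses `S`** (the previous theorem for `-τ` and the reversed parameter).
[cite: HawkingEllis1973CUP, §6.6, Prop. 6.6.3] [cite: ONeillSemiRiemannian1983, Ch. 14, Thm. 14.38] -/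
theorem false_of_curve_in_shadowDomain_past (hsm : (∞ : ℕ∞ω) ≤ n)
    (hcwb : g.IsCausallyWellBehaved τ) (hιc : Continuous ι)
    (hac : ∀ p ∈ range ι, ∀ q ∈ range ι, q ∈ g.causalFuture τ {p} → q = p)
    (hLT : ∀ u : X', ∃ B : Set M, IsOpen B ∧ ι u ∈ B ∧
      B ⊆ range ι ∪ g.chronologicalFuture τ (range ι) ∪ g.chronologicalPast τ (range ι))
    (hrel : ∀ {xs ys : ℕ → M} {x y : M}, Tendsto xs atTop (𝓝 x) → Tendsto ys atTop (𝓝 y) →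
      (∀ j, ys j ∈ g.causalFuture τ {xs j}) → y ∈ g.causalFuture τ {x})
    (hKC' : ∀ C : Set M, IsCompact C → ∀ y : M,
      IsCompact (g.causalPast τ C ∩ g.causalFuture τ {y}))
    (himp' : ∀ K : Set M, IsCompact K → ∀ (γ : ℝ → M) (s : Set ℝ), s.OrdConnected →
      g.IsFutureCausalCurveOn τ γ s → IsFutureEndless γ s → ∀ t₀ ∈ s, ∃ t ∈ s, t₀ ≤ t ∧ γ t ∉ K)
    {Vp Vm : Set M}
    (hVp : Vp = {y | y ∈ g.chronologicalFuture τ (range ι) ∧ ∃ x ∈ g.chronologicalFuture τ {y},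
      ∃ K : Set X', IsCompact K ∧ ι ⁻¹' g.causalPast τ {x} ⊆ K})
    (hVm : Vm = {y | y ∈ g.chronologicalPast τ (range ι) ∧ ∃ x ∈ g.chronologicalPast τ {y},
      ∃ K : Set X', IsCompact K ∧ ι ⁻¹' g.causalFuture τ {x} ⊆ K})
    {γ : ℝ → M} {s : Set ℝ} (hs : s.OrdConnected) (hγ : g.IsFutureTimelikeCurveOn τ γ s)
    (hγV : ∀ t ∈ s, γ t ∈ range ι ∪ Vp ∪ Vm) (hmiss : ∀ t ∈ s, γ t ∉ range ι)
    {t₀ : ℝ} (ht₀ : t₀ ∈ s) (hp : γ t₀ ∈ Vm)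
    (hend : ∀ e ∈ range ι ∪ Vp ∪ Vm, ¬ HasFutureEndpoint γ s e) : False := by
  have hac' : ∀ p ∈ range ι, ∀ q ∈ range ι, q ∈ g.causalFuture τ.reverse {p} → q = p :=
    fun p hp q hq h ↦ (hac q hq p hp (mem_causalPast_singleton_iff.1 h)).symm
  have hLT' : ∀ u : X', ∃ B : Set M, IsOpen B ∧ ι u ∈ B ∧
      B ⊆ range ι ∪ g.chronologicalFuture τ.reverse (range ι) ∪
        g.chronologicalPast τ.reverse (range ι) := by
    intro u
    obtain ⟨B, hB, huB, hBO⟩ := hLT u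
    refine ⟨B, hB, huB, fun z hz ↦ ?_⟩
    rw [chronologicalPast_reverse]
    rcases hBO hz with (h | h) | h
    · exact Or.inl (Or.inl h)
    · exact Or.inr h
    · exact Or.inl (Or.inr h)
  have hrel' : ∀ {xs ys : ℕ → M} {x y : M}, Tendsto xs atTop (𝓝 x) → Tendsto ys atTop (𝓝 y) →
      (∀ j, ys j ∈ g.causalFuture τ.reverse {xs j}) → y ∈ g.causalFuture τ.reverse {x} := by
    intro xs ys x y hx hy h
    show y ∈ g.causalPast τ {x}
    exact mem_causalPast_singleton_iff.2 (hrel hy hx fun j ↦ mem_causalPast_singleton_iff.1 (h j))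
  have hKC'' : ∀ C : Set M, IsCompact C → ∀ y : M,
      IsCompact (g.causalFuture τ.reverse C ∩ g.causalPast τ.reverse {y}) := by
    intro C hC y
    rw [causalPast_reverse]
    exact hKC' C hC y
  have himp'' : ∀ K : Set M, IsCompact K → ∀ (γ : ℝ → M) (s : Set ℝ), s.OrdConnected →
      g.IsFutureCausalCurveOn τ.reverse γ s → IsPastEndless γ s → ∀ t₀ ∈ s,
      ∃ t ∈ s, t ≤ t₀ ∧ γ t ∉ K := by
    intro K hK γ s hs hγ hend t₀ ht₀
    have hγ' : g.IsFutureCausalCurveOn τ (fun t ↦ γ (-t)) (Neg.neg ⁻¹' s) :=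
      isFutureCausalCurveOn_reverse_reverse_iff.1 hγ.comp_neg
    have hend' : IsFutureEndless (fun t ↦ γ (-t)) (Neg.neg ⁻¹' s) :=
      isFutureEndless_comp_neg_iff.2 hend
    obtain ⟨t, ht, ht₀t, htK⟩ := himp' K hK _ _ (ordConnected_preimage_neg hs) hγ' hend' (-t₀)
      (show -(-t₀) ∈ s by rw [neg_neg]; exact ht₀)
    exact ⟨-t, ht, by linarith, htK⟩
  -- the sets `V±` for `-τ` are `V∓`
  have hVp' : Vm = {y | y ∈ g.chronologicalFuture τ.reverse (range ι) ∧
      ∃ x ∈ g.chronologicalFuture τ.reverse {y},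
        ∃ K : Set X', IsCompact K ∧ ι ⁻¹' g.causalPast τ.reverse {x} ⊆ K} := by
    rw [hVm]
    simp only [causalPast_reverse]
    rfl
  have hVm' : Vp = {y | y ∈ g.chronologicalPast τ.reverse (range ι) ∧
      ∃ x ∈ g.chronologicalPast τ.reverse {y},
        ∃ K : Set X', IsCompact K ∧ ι ⁻¹' g.causalFuture τ.reverse {x} ⊆ K} := by
    rw [hVp]
    simp only [chronologicalPast_reverse, causalPast]
  -- the reversed curve
  have hγ' : g.IsFutureTimelikeCurveOn τ.reverse (fun t ↦ γ (-t)) (Neg.neg ⁻¹' s) := hγ.comp_neg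
  have hγV' : ∀ t ∈ Neg.neg ⁻¹' s, γ (-t) ∈ range ι ∪ Vm ∪ Vp := by
    intro t ht
    rcases hγV (-t) ht with (h | h) | h
    · exact Or.inl (Or.inl h)
    · exact Or.inr h
    · exact Or.inl (Or.inr h)
  have hend' : ∀ e ∈ range ι ∪ Vm ∪ Vp, ¬ HasPastEndpoint (fun t ↦ γ (-t)) (Neg.neg ⁻¹' s) e := by
    intro e he h
    have he' : e ∈ range ι ∪ Vp ∪ Vm := by
      rcases he with (h | h) | h
      · exact Or.inl (Or.inl h)
      · exact Or.inr h
      · exact Or.inl (Or.inr h)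
    exact hend e he' (hasPastEndpoint_comp_neg_iff.1 h)
  exact false_of_curve_in_shadowDomain_future (τ := τ.reverse) hsm hcwb.reverse hιc hac' hLT'
    hrel' hKC'' himp'' hVp' hVm' (ordConnected_preimage_neg hs) hγ' hγV'
    (fun t ht ↦ hmiss (-t) ht) (show -(-t₀) ∈ s by rw [neg_neg]; exact ht₀)
    (by rw [neg_neg]; exact hp) hend'

/-! ### `S` is a Cauchy hypersurface of the shadow domain -/

/-- **The hypersurface is a Cauchy hypersurface of its shadow domain** (O'Neill 1983, Thm. 14.38 /
Hawking–Ellis 1973, Prop. 6.6.3, shadow form): every endless timelike curve of the open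
sub-spacetime `V = S ∪ V⁺ ∪ V⁻` meets `S` exactly once — at most once by acausality, at least once
by `false_of_curve_in_shadowDomain_future` / `_past` applied at its base point.
[cite: ONeillSemiRiemannian1983, Ch. 14, Thm. 14.38 (p. 422)] [cite: HawkingEllis1973CUP, §6.6, Prop. 6.6.3] -/
theorem isCauchyHypersurface_shadowDomain (hsm : (∞ : ℕ∞ω) ≤ n)
    (hres : PseudoRiemannianMetric.contMDiff_restrict (I := I) (n := n) (M := M))
    (hτ : τ.contMDiff_restrict)
    (hcwb : g.IsCausallyWellBehaved τ) (hιc : Continuous ι)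
    (hac : ∀ p ∈ range ι, ∀ q ∈ range ι, q ∈ g.causalFuture τ {p} → q = p)
    (hLT : ∀ u : X', ∃ B : Set M, IsOpen B ∧ ι u ∈ B ∧
      B ⊆ range ι ∪ g.chronologicalFuture τ (range ι) ∪ g.chronologicalPast τ (range ι))
    (hrel : ∀ {xs ys : ℕ → M} {x y : M}, Tendsto xs atTop (𝓝 x) → Tendsto ys atTop (𝓝 y) →
      (∀ j, ys j ∈ g.causalFuture τ {xs j}) → y ∈ g.causalFuture τ {x})
    (hKC : ∀ C : Set M, IsCompact C → ∀ y : M,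
      IsCompact (g.causalFuture τ C ∩ g.causalPast τ {y}))
    (hKC' : ∀ C : Set M, IsCompact C → ∀ y : M,
      IsCompact (g.causalPast τ C ∩ g.causalFuture τ {y}))
    (himp : ∀ K : Set M, IsCompact K → ∀ (γ : ℝ → M) (s : Set ℝ), s.OrdConnected →
      g.IsFutureCausalCurveOn τ γ s → IsPastEndless γ s → ∀ t₀ ∈ s, ∃ t ∈ s, t ≤ t₀ ∧ γ t ∉ K)
    (himp' : ∀ K : Set M, IsCompact K → ∀ (γ : ℝ → M) (s : Set ℝ), s.OrdConnected →
      g.IsFutureCausalCurveOn τ γ s → IsFutureEndless γ s → ∀ t₀ ∈ s, ∃ t ∈ s, t₀ ≤ t ∧ γ t ∉ K)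
    {Vp Vm : Set M}
    (hVp : Vp = {y | y ∈ g.chronologicalFuture τ (range ι) ∧ ∃ x ∈ g.chronologicalFuture τ {y},
      ∃ K : Set X', IsCompact K ∧ ι ⁻¹' g.causalPast τ {x} ⊆ K})
    (hVm : Vm = {y | y ∈ g.chronologicalPast τ (range ι) ∧ ∃ x ∈ g.chronologicalPast τ {y},
      ∃ K : Set X', IsCompact K ∧ ι ⁻¹' g.causalFuture τ {x} ⊆ K})
    (hVo : IsOpen (range ι ∪ Vp ∪ Vm)) :
    (g.restrict hres ⟨_, hVo⟩).IsCauchyHypersurface (τ.restrict hres hτ ⟨_, hVo⟩)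
      (Subtype.val ⁻¹' range ι) := by
  intro γ s hγ
  obtain ⟨hs, hγt, hγf, hγp⟩ := hγ
  have hγM : g.IsFutureTimelikeCurveOn τ (Subtype.val ∘ γ) s :=
    (isFutureTimelikeCurveOn_restrict_iff g τ hres hτ _).1 hγt
  have hγV : ∀ t ∈ s, (Subtype.val ∘ γ) t ∈ range ι ∪ Vp ∪ Vm := fun t _ ↦ (γ t).2
  -- existence of a crossing
  have hex : ∃ t ∈ s, (Subtype.val ∘ γ) t ∈ range ι := by
    by_contra hmiss
    push Not at hmiss
    obtain ⟨t₀, ht₀⟩ := hγf.1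
    rcases hγV t₀ ht₀ with (hS | hp) | hm
    · exact hmiss t₀ ht₀ hS
    · exact false_of_curve_in_shadowDomain_future hsm hcwb hιc hac hLT hrel hKC himp hVp hVm hs
        hγM hγV hmiss ht₀ hp fun e heV hE ↦
          hγp.2 ⟨e, heV⟩ (hasPastEndpoint_subtypeVal_comp_iff.1 hE)
    · exact false_of_curve_in_shadowDomain_past hsm hcwb hιc hac hLT hrel hKC' himp' hVp hVm hs
        hγM hγV hmiss ht₀ hm fun e heV hE ↦
          hγf.2 ⟨e, heV⟩ (hasFutureEndpoint_subtypeVal_comp_iff.1 hE)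
  obtain ⟨t, hts, htS⟩ := hex
  refine ⟨t, ⟨hts, htS⟩, fun t' ht' ↦ ?_⟩
  -- uniqueness: two crossings would be chronologically related points of `S`
  by_contra hne
  rcases lt_or_gt_of_ne hne with hlt | hlt
  · have h : (Subtype.val ∘ γ) t ∈ g.chronologicalFuture τ (range ι) :=
      ⟨(Subtype.val ∘ γ) t', ht'.2, Subtype.val ∘ γ, t', t, hlt, hγM.mono (hs.out ht'.1 hts),
        rfl, rfl⟩
    exact not_mem_range_of_mem_chronologicalFuture_range hcwb hac h htS
  · have h : (Subtype.val ∘ γ) t' ∈ g.chronologicalFuture τ (range ι) :=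
      ⟨(Subtype.val ∘ γ) t, htS, Subtype.val ∘ γ, t, t', hlt, hγM.mono (hs.out hts ht'.1),
        rfl, rfl⟩
    exact not_mem_range_of_mem_chronologicalFuture_range hcwb hac h ht'.2

end LorentzianMetric

end Literature.Geometry.Lorentzian

end
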